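import Summits.ABC.StewartYu.NesterenkoZeroEnd
import Summits.ABC.StewartYu.MatveevLeverMinors
import HarnessLib

/-!
# Nesterenko 2003, §5.2: exit C of the zero-estimate END against the record's weights

Cell topic `Summits/ABC/StewartYu` (cell abc-stewartyu, seat p4); namespace
`Summit.ABC.StewartYu.ZeroEnd` (theorems only). Sequel of `NesterenkoZeroEnd.lean` /
`MatveevLeverMinors.lean`: the last display of Nesterenko 2003, §5.2 before (5.22) — the
conversion of the zero estimate's minors sum `∑_I |det M_I| ∏_{j∉I} Dⱼ` (inside `GaGm.nesterenkoH`)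
into the lever's `∑_I |det M_I| ∏_{i∈I} Aᵢ` under the record's hypothesis `1 ≤ κ Aⱼ Dⱼ`
("`L/Aⱼ ≤ 2^{n+24} Dⱼ`", `κ = 2^{n+24}/L`), and the resulting ONE-CALL bound for exit C:

* `prod_weights_le` — `∏_{i∈I} Aᵢ ≤ Ω · κ^{#(univ∖I)} · ∏_{j∉I} Dⱼ` (`Ω = ∏ Aⱼ`);
* `sum_absMinor_weights_le` — `∑_{|I|=r} |det M_I| ∏_{i∈I} Aᵢ ≤ Ω κ^{n−r} ∑_{|I|=r} |det M_I| ∏_{j∉I} Dⱼ`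
  ("`V(Ψ) ≤ 2^{(n−r)(n+24)} Ω L^{r−n} ∑ |det M| D_{j₁}⋯D_{j_{n−r}}`");
* `zeroEnd_exitC` — from the exit-C inequality of `zeroEnd`
  (`binom(S₀+(r−d₀), r−d₀)·(2X+1)·𝓗(G*) ≤ (n+1)! 2ⁿ D₀ ∏ Dⱼ`) and `k b = ∑ cᵢ Mᵢ`: short vectors
  `zᵢ ∈ Φ` and `m₀ b = ∑ mᵢ zᵢ` with
  `∏ᵢ‖zᵢ‖_A · binom(…)·(2X+1)·(d₀+n−r)!·2^{n−r}·D₀^{d₀} ≤ 2^r (Γ(r/2+1)/√π^r) √n^r Ω κ^{n−r} (n+1)! 2ⁿ D₀ ∏ Dⱼ`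
  plus (2.11)/(2.12) — every remaining step ((5.12), (5.16)–(5.18), (5.22)) is the record's arithmetic.

WHAT THIS IS NOT: no numerics; no zero estimate (hypothesis of `zeroEnd`).

## References

* [Nesterenko2003] Yu. V. Nesterenko, *Linear forms in logarithms of rational numbers*, LNM 1819
  (2003), 53–106: §5.2, the displays between (5.21) and (5.22), p. 103.
-/

noncomputable section

namespace Summit.ABC.StewartYu.ZeroEnd

open Matrix Finset
open Literature.NumberTheory.Transcendental.GaGm

/-- `∏_{i∈I} Aᵢ ≤ (∏ⱼ Aⱼ) · κ^{#(univ ∖ I)} · ∏_{j ∉ I} Dⱼ` when `1 ≤ κ Aⱼ Dⱼ` for all `j`.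
[cite: Nesterenko2003, §5.2 ("L/Aᵢ ≤ 2^S/N Dⱼ ≤ 2^{n+24} Dⱼ"), p. 103] -/
theorem prod_weights_le {n : ℕ} (A : Fin n → ℝ) (hA : ∀ j, 0 < A j) (D : Fin n → ℕ) (κ : ℝ)
    (hAD : ∀ j, 1 ≤ κ * A j * D j) (I : Finset (Fin n)) :
    ∏ i ∈ I, A i ≤ (∏ j, A j) * (κ ^ (univ \ I).card * ∏ j ∈ univ \ I, (D j : ℝ)) := by
  classical
  rw [← Finset.prod_mul_prod_compl I A, Finset.compl_eq_univ_sdiff, mul_assoc]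
  have hI : 0 ≤ ∏ i ∈ I, A i := Finset.prod_nonneg fun i _ => (hA i).le
  have h1 : (1 : ℝ) ≤ (∏ j ∈ univ \ I, A j) * (κ ^ (univ \ I).card * ∏ j ∈ univ \ I, (D j : ℝ)) := by
    rw [← Finset.prod_const, ← Finset.prod_mul_distrib, ← Finset.prod_mul_distrib]
    calc (1 : ℝ) = ∏ j ∈ univ \ I, (1 : ℝ) := by simp
      _ ≤ ∏ j ∈ univ \ I, A j * (κ * (D j : ℝ)) :=
          Finset.prod_le_prod (fun j _ => zero_le_one) fun j _ => by
            calc (1 : ℝ) ≤ κ * A j * D j := hAD j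
              _ = A j * (κ * (D j : ℝ)) := by ring
  calc ∏ i ∈ I, A i = (∏ i ∈ I, A i) * 1 := (mul_one _).symm
    _ ≤ (∏ i ∈ I, A i) * ((∏ j ∈ univ \ I, A j) * (κ ^ (univ \ I).card * ∏ j ∈ univ \ I, (D j : ℝ))) :=
        mul_le_mul_of_nonneg_left h1 hI

/-- **The minors sum against the record's weights**:
`∑_{|I|=r} |det M_I| ∏_{i∈I} Aᵢ ≤ (∏ Aⱼ) κ^{n−r} ∑_{|I|=r} |det M_I| ∏_{j∉I} Dⱼ` when `1 ≤ κ Aⱼ Dⱼ`.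
[cite: Nesterenko2003, §5.2 (display after (5.21)), p. 103] -/
theorem sum_absMinor_weights_le {n r : ℕ} (M : Matrix (Fin r) (Fin n) ℤ) (A : Fin n → ℝ)
    (hA : ∀ j, 0 < A j) (D : Fin n → ℕ) (κ : ℝ) (hAD : ∀ j, 1 ≤ κ * A j * D j) :
    ∑ I ∈ (univ : Finset (Fin n)).powersetCard r, (absMinor M I : ℝ) * ∏ i ∈ I, A i ≤
      (∏ j, A j) * κ ^ (n - r) *
        ∑ I ∈ (univ : Finset (Fin n)).powersetCard r, (absMinor M I : ℝ) * ∏ j ∈ univ \ I, (D j : ℝ) := by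
  classical
  rw [Finset.mul_sum]
  refine Finset.sum_le_sum fun I hI => ?_
  have hcard : (univ \ I).card = n - r := by
    rw [Finset.card_sdiff_of_subset (Finset.subset_univ _), Finset.card_univ, Fintype.card_fin,
      (Finset.mem_powersetCard.mp hI).2]
  have h := prod_weights_le A hA D κ hAD I
  rw [hcard] at h
  calc (absMinor M I : ℝ) * ∏ i ∈ I, A i
      ≤ (absMinor M I : ℝ) * ((∏ j, A j) * (κ ^ (n - r) * ∏ j ∈ univ \ I, (D j : ℝ))) :=
        mul_le_mul_of_nonneg_left h (Nat.cast_nonneg _)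
    _ = (∏ j, A j) * κ ^ (n - r) * ((absMinor M I : ℝ) * ∏ j ∈ univ \ I, (D j : ℝ)) := by ring

/-- **Exit C of the END, one call** (Nesterenko 2003, §5.2, last display before (5.22)): from the
exit-C inequality of `zeroEnd` — `binom(S₀+(r−d₀), r−d₀)·(2X+1)·𝓗 ≤ (n+1)! 2ⁿ D₀ ∏ Dⱼ` with
`𝓗 = nesterenkoH n r d₀ M D₀ D` — an integer relation `k b = ∑ cᵢ Mᵢ` (`k ≠ 0`, `1 ≤ r`), weights
`Aⱼ > 0` and the record's `1 ≤ κ Aⱼ Dⱼ` (`κ ≥ 0`): there are `ℤ`-independent `z₁, …, z_r ∈ Φ`,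
`m₀ ≠ 0`, `m`, `J` (`#J = r`) with `m₀ b = ∑ mᵢ zᵢ`,
`(∏ᵢ ‖zᵢ‖_A) · (binom·(2X+1)·((d₀+(n−r))!·2^{n−r}·D₀^{d₀})) ≤
 2^r (Γ(r/2+1)/√π^r) (√n^r) (∏ Aⱼ) κ^{n−r} (n+1)! 2ⁿ D₀ ∏ Dⱼ`, and (2.11)/(2.12).
[cite: Nesterenko2003, §5.2 pp. 103–104 and Prop 2.6 (2.9)–(2.13)] -/
theorem zeroEnd_exitC {n r d₀ X S₀ D₀ : ℕ} (D : Fin n → ℕ) (hr : 0 < r)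
    (M : Matrix (Fin r) (Fin n) ℤ) (hM : LinearIndependent ℤ (fun i => M i))
    (hineq : Nat.choose (S₀ + (r - d₀)) (r - d₀) * (2 * X + 1) * nesterenkoH n r d₀ M D₀ D ≤
      (n + 1).factorial * 2 ^ n * D₀ * ∏ j, D j)
    (A : Fin n → ℝ) (hA : ∀ j, 0 < A j) (κ : ℝ) (hκ : 0 ≤ κ) (hAD : ∀ j, 1 ≤ κ * A j * D j)
    (b : Fin n → ℤ) (k : ℤ) (hk : k ≠ 0) (c : Fin r → ℤ) (hbk : k • b = ∑ i, c i • M i) :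
    ∃ (z : Fin r → (Fin n → ℤ)) (m₀ : ℤ) (m : Fin r → ℤ) (J : Finset (Fin n)),
      (∀ i, z i ∈ Submodule.span ℤ (Set.range fun i => M i)) ∧
      LinearIndependent ℤ z ∧ m₀ ≠ 0 ∧ m₀ • b = ∑ i, m i • z i ∧ J.card = r ∧
      (∏ i, ∑ j, A j * |(z i j : ℝ)|) *
          ((Nat.choose (S₀ + (r - d₀)) (r - d₀) : ℝ) * (2 * X + 1) *
            ((d₀ + (n - r)).factorial * 2 ^ (n - r) * (D₀ : ℝ) ^ d₀)) ≤
        2 ^ r * (Real.Gamma ((r : ℝ) / 2 + 1) / Real.sqrt Real.pi ^ r) * Real.sqrt n ^ r *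
          ((∏ j, A j) * κ ^ (n - r)) * ((n + 1).factorial * 2 ^ n * (D₀ : ℝ) * ∏ j, (D j : ℝ)) ∧
      |(m₀ : ℝ)| * ∏ j ∈ J, A j ≤ ∏ i, ∑ j, A j * |(z i j : ℝ)| ∧
      ∀ i, |(m i : ℝ)| * ∏ j ∈ J, A j ≤
        (∑ j ∈ J, |(b j : ℝ)| * A j) * ∏ i' ∈ univ.erase i, ∑ j, A j * |(z i' j : ℝ)| := by
  classical
  obtain ⟨z, m₀, m, J, h1, h2, h3, h4, h5, h6, h7, h8⟩ :=
    MatveevLever.exists_short_relation_absMinor hr A hA (fun i => M i) hM b k hk c hbk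
  refine ⟨z, m₀, m, J, h1, h2, h3, h4, h5, ?_, h7, h8⟩
  -- abbreviations
  set P : ℝ := ∏ i, ∑ j, A j * |(z i j : ℝ)| with hP
  set K : ℝ := 2 ^ r * (Real.Gamma ((r : ℝ) / 2 + 1) / Real.sqrt Real.pi ^ r) with hK
  set SA : ℝ := ∑ I ∈ (univ : Finset (Fin n)).powersetCard r, (absMinor M I : ℝ) * ∏ i ∈ I, A i
    with hSA
  set SD : ℝ := ∑ I ∈ (univ : Finset (Fin n)).powersetCard r,
    (absMinor M I : ℝ) * ∏ j ∈ univ \ I, (D j : ℝ) with hSD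
  set C₀ : ℝ := (Nat.choose (S₀ + (r - d₀)) (r - d₀) : ℝ) * (2 * X + 1) *
    ((d₀ + (n - r)).factorial * 2 ^ (n - r) * (D₀ : ℝ) ^ d₀) with hC₀
  set R₀ : ℝ := (n + 1).factorial * 2 ^ n * (D₀ : ℝ) * ∏ j, (D j : ℝ) with hR₀
  have hMof : (Matrix.of fun i => M i) = M := rfl
  have hK0 : 0 ≤ K := by
    rw [hK]
    exact mul_nonneg (pow_nonneg zero_le_two _) (div_nonneg
      (Real.Gamma_pos_of_pos (by positivity)).le (pow_nonneg (Real.sqrt_nonneg _) _))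
  have hsn : 0 ≤ Real.sqrt n ^ r := pow_nonneg (Real.sqrt_nonneg _) _
  have hΩ : 0 ≤ (∏ j, A j) * κ ^ (n - r) :=
    mul_nonneg (Finset.prod_nonneg fun j _ => (hA j).le) (pow_nonneg hκ _)
  have hC0 : 0 ≤ C₀ := by rw [hC₀]; positivity
  -- the lever: `P ≤ K √n^r SA`
  have hlev : P ≤ K * (Real.sqrt n ^ r * SA) := by
    have h := h6
    rw [hMof] at h
    exact h
  -- the weights: `SA ≤ Ω κ^{n-r} SD`
  have hw : SA ≤ (∏ j, A j) * κ ^ (n - r) * SD := sum_absMinor_weights_le M A hA D κ hAD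
  -- the zero estimate: `C₀ SD ≤ R₀`
  have hz : C₀ * SD ≤ R₀ := by
    have h : ((Nat.choose (S₀ + (r - d₀)) (r - d₀) * (2 * X + 1) * nesterenkoH n r d₀ M D₀ D : ℕ) : ℝ)
        ≤ (((n + 1).factorial * 2 ^ n * D₀ * ∏ j, D j : ℕ) : ℝ) := by exact_mod_cast hineq
    have hlhs : ((Nat.choose (S₀ + (r - d₀)) (r - d₀) * (2 * X + 1) * nesterenkoH n r d₀ M D₀ D : ℕ) : ℝ)
        = C₀ * SD := by
      rw [hC₀, hSD, nesterenkoH]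
      push_cast
      ring
    have hrhs : (((n + 1).factorial * 2 ^ n * D₀ * ∏ j, D j : ℕ) : ℝ) = R₀ := by
      rw [hR₀]; push_cast; ring
    rw [hlhs, hrhs] at h
    exact h
  -- assemble
  calc P * C₀ ≤ K * (Real.sqrt n ^ r * SA) * C₀ := mul_le_mul_of_nonneg_right hlev hC0
    _ ≤ K * (Real.sqrt n ^ r * ((∏ j, A j) * κ ^ (n - r) * SD)) * C₀ :=
        mul_le_mul_of_nonneg_right
          (mul_le_mul_of_nonneg_left (mul_le_mul_of_nonneg_left hw hsn) hK0) hC0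
    _ = K * Real.sqrt n ^ r * ((∏ j, A j) * κ ^ (n - r)) * (C₀ * SD) := by ring
    _ ≤ K * Real.sqrt n ^ r * ((∏ j, A j) * κ ^ (n - r)) * R₀ :=
        mul_le_mul_of_nonneg_left hz (mul_nonneg (mul_nonneg hK0 hsn) hΩ)
    _ = 2 ^ r * (Real.Gamma ((r : ℝ) / 2 + 1) / Real.sqrt Real.pi ^ r) * Real.sqrt n ^ r *
          ((∏ j, A j) * κ ^ (n - r)) * ((n + 1).factorial * 2 ^ n * (D₀ : ℝ) * ∏ j, (D j : ℝ)) := by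
        rw [hK, hR₀]

end Summit.ABC.StewartYu.ZeroEnd

end
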